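import Literature.Computability.AlgebraicComplexity.VonZurGathenSingPermHeight

/-!
# Crux `MonotoneCoverHard` (stmt-ValiantsHypothesis-7421): (R) von zur Gathen's REGULARITY theorem
# for affine determinantal expressions of `per_n` — from the tree's unconditional Thm. 3.1

The line of record for crux 7421 (`Cruxes/MonotoneCoverHard/REGULARITY-GRADED.md`,
`Cruxes/MonotoneCoverHard/GradedSketch.lean`, refuter val-width-7421-d1) reduces the registered stub
`stub_width` — and with it `MonotoneCoverHard` by name (`monotoneCoverHard_of_widthBet`) — to ONE
input, stated there as the `Prop`

  `Regularity := ∀ n m (L : Matrix (Fin m) (Fin m) (MvPolynomial (Fin n × Fin n) ℂ)), 3 ≤ n →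
     (∀ i j, (L i j).totalDegree ≤ 1) → L.det = perPoly (Fin n) ℂ →
     m ≤ (L.map MvPolynomial.constantCoeff).rank + 1`,

i.e. von zur Gathen's regularity theorem [J. von zur Gathen, *Permanent and determinant*, Linear
Algebra Appl. 96 (1987) 87–100, Thm. 3.1; Landsberg, *Geometry and Complexity Theory* (2017)
Prop. 6.3.3.6 + 6.3.4.1; Alper–Bogart–Velasco, arXiv:1505.02205, Prop. 2.1]: an affine-linear square
matrix over `ℂ[x_{ij}]` with determinant `per_n`, `n ≥ 3`, has constant part of rank `≥ m - 1`.

This theorem is ALREADY PROVED in the tree, in a stronger form (any polynomial entries, every base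
point, any infinite field of characteristic `≠ 2`):
`Literature.Computability.AlgebraicComplexity.vonzurGathen1987_perm_detRepr_rank_holds`
(`Literature/Computability/AlgebraicComplexity/VonZurGathenSingPermHeight.lean`; its inputs are
vzG Lemma 2.3 in height form — every prime containing `per_m` and its partials has height `≥ 5`,
proved there by an explicit chain of five primes — and Eagon's height bound `≤ 4` for the ideal of
submaximal minors, `VonZurGathenRegularityProofs.lean`; the chain-rule step and the assembly are
`VonZurGathenRegularity.lean`).  This file records the corollaries the crux line consumes:

* `rank_eval_add_one_of_det_eq_perPoly` — every-point form over `ℂ`: `m ≤ rank L(v) + 1`;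
* `rank_constantCoeff_add_one_of_det_eq_perPoly` — the constant part: `m ≤ rank L(0) + 1`
  (`constantCoeff = eval 0`), no degree hypothesis;
* `rank_constantCoeff_add_one_eq_of_det_eq_perPoly` — equality `rank L(0) + 1 = m`
  (`det L(0) = per_n(0) = 0`);
* `regularity` — the statement of `GradedSketch.Regularity` VERBATIM (its degree hypothesis is not
  needed and not used), so that `stub_width_of_regularity regularity` and
  `monotoneCoverHard_of_regularity regularity` typecheck as written there.

No definitions.  VP ≠ VNP is not moved: `MonotoneCoverHard` is the route's monotone crux and this
file only supplies its algebraic-geometry input.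
-/

namespace Summit.ValiantsHypothesis.ValiantsHypothesis.Theorems.PolyaContinuedMonotoneCoverHard

-- summit = sub-problem name (single-conjunct summit, D-0017 layout), so the namespace repeats it
set_option linter.dupNamespace false

open Literature.Computability.AlgebraicComplexity
  (perPoly constantCoeff_perPoly vonzurGathen1987_perm_detRepr_rank_holds)

/-- **von zur Gathen 1987, Thm. 3.1, every-point form over `ℂ`**: if `det L = per_n` for a square
matrix `L` of polynomials in the `n²` variables, `n ≥ 3`, then `rank L(v) ≥ m - 1` at every point
`v`.  Specialisation of the tree's `vonzurGathen1987_perm_detRepr_rank_holds` to `F = ℂ`.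
[cite: Vonzurgathen1987, Thm. 3.1] -/
theorem rank_eval_add_one_of_det_eq_perPoly {n m : ℕ} (hn : 3 ≤ n)
    (L : Matrix (Fin m) (Fin m) (MvPolynomial (Fin n × Fin n) ℂ))
    (hdet : L.det = perPoly (Fin n) ℂ) (v : Fin n × Fin n → ℂ) :
    m ≤ (L.map (MvPolynomial.eval v)).rank + 1 :=
  vonzurGathen1987_perm_detRepr_rank_holds ℂ two_ne_zero n hn m L hdet v

/-- **Regularity of the constant part**: if `det L = per_n`, `n ≥ 3`, then the matrix of constant
coefficients `L(0)` has rank `≥ m - 1` (von zur Gathen 1987 Thm. 3.1 at the origin; Landsberg 2017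
Prop. 6.3.4.1 with Prop. 6.3.3.6; ABV15 Prop. 2.1).  No degree hypothesis on the entries.
[cite: Vonzurgathen1987, Thm. 3.1] -/
theorem rank_constantCoeff_add_one_of_det_eq_perPoly {n m : ℕ} (hn : 3 ≤ n)
    (L : Matrix (Fin m) (Fin m) (MvPolynomial (Fin n × Fin n) ℂ))
    (hdet : L.det = perPoly (Fin n) ℂ) :
    m ≤ (L.map MvPolynomial.constantCoeff).rank + 1 := by
  have h := rank_eval_add_one_of_det_eq_perPoly hn L hdet 0
  rwa [MvPolynomial.eval_zero] at h

/-- **Equality form**: if `det L = per_n`, `n ≥ 3`, then `rank L(0) + 1 = m` — the constant part has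
corank exactly one (`≤ m - 1` because `det L(0) = per_n(0) = 0`, `≥ m - 1` by regularity).
[cite: Vonzurgathen1987, Thm. 3.1] -/
theorem rank_constantCoeff_add_one_eq_of_det_eq_perPoly {n m : ℕ} (hn : 3 ≤ n)
    (L : Matrix (Fin m) (Fin m) (MvPolynomial (Fin n × Fin n) ℂ))
    (hdet : L.det = perPoly (Fin n) ℂ) :
    (L.map MvPolynomial.constantCoeff).rank + 1 = m := by
  have hle := rank_constantCoeff_add_one_of_det_eq_perPoly hn L hdet
  have hdet0 : (L.map MvPolynomial.constantCoeff).det = 0 := by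
    have hmap : (L.map MvPolynomial.constantCoeff).det = MvPolynomial.constantCoeff L.det := by
      rw [RingHom.map_det]; rfl
    rw [hmap, hdet, constantCoeff_perPoly ℂ (show 1 ≤ n by omega)]
  have hlt := Literature.Computability.AlgebraicComplexity.Matrix.rank_lt_card_of_det_eq_zero hdet0
  rw [Fintype.card_fin] at hlt
  omega

/-- **(R) `Regularity` of `Cruxes/MonotoneCoverHard/GradedSketch.lean`, VERBATIM**: every
affine-linear `m × m` matrix over `ℂ[x_{ij}]` whose determinant is `per_n`, `n ≥ 3`, has constant part
of rank `≥ m - 1`.  The degree hypothesis of the sketch is carried (to match its statement literally)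
but not used.  With this, the sketch's `stub_width_of_regularity` / `monotoneCoverHard_of_regularity`
apply to `regularity`. [cite: Vonzurgathen1987, Thm. 3.1] -/
theorem regularity :
    ∀ (n m : ℕ) (L : Matrix (Fin m) (Fin m) (MvPolynomial (Fin n × Fin n) ℂ)), 3 ≤ n →
      (∀ i j, (L i j).totalDegree ≤ 1) →
      L.det = Literature.Computability.AlgebraicComplexity.perPoly (Fin n) ℂ →
      m ≤ (L.map MvPolynomial.constantCoeff).rank + 1 :=
  fun _ _ L hn _ hdet => rank_constantCoeff_add_one_of_det_eq_perPoly hn L hdet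

end Summit.ValiantsHypothesis.ValiantsHypothesis.Theorems.PolyaContinuedMonotoneCoverHard
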